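import Summits.QuantumFields.BalabanUV.T4Continuum.Support.ShellMeasureLandauEndAssembledDecayReachBox
import Summits.QuantumFields.BalabanUV.T4Continuum.Support.ShellMeasureLandauEndAssembledToy

/-!
# `T4Continuum.ShellMeasureLandauEndAssembledDecayReachToyData` — row S80 f7 «SAME-BOX JUNCTION WITNESS», file 1 (DATA):
# the corner plaquette of a side-2 box, its block bond off the axial comb, the comb path, the RESET configuration, the
# four-letter perturbation bound, the block read-out — the lattice side of firing S80 f6 on ONE datum
(cell `pub-balaban`, sub-cell `t4`, spine estimate NE7c (node U5b); NE7c ROUND-2 crew, unit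
`b2b-balaban-t4-ne7c-formalise-leaf-03` gen 7; owner table `t4/b2b-balaban-t4-ne7c-p1/LEAVES-NE7c-P1.md` row **S80 f7** (owner GO
R-ne7cp1-g34-2 (f) l.19716 «it is f6's (x1)»; OFFER l.19668; answers leaf-05-g9's XREAD INFO C-ne7cL05g9-4 «a same-box junction
witness is in neither file»); ADDITIVE — imports S80 f6 `ShellMeasureLandauEndAssembledDecayReachBox` (p232354) + leaf-01-g8's S80 f4
`ShellMeasureLandauEndAssembledToy` (p230964; hence leaf-04's S88 `ShellMeasureLandauEndFinalToy` and the SU(2) dictionary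
`ShellMeasureWilsonRealizedSU2Words`) ONLY; leaf-10-g11's S89 `ShellMeasureLevelZeroBoxWitness` box lemmas BY NAME (via S87 f4);
[folklore]; DATA `def`s (`b₀`, `p₀`, `pathX`, `reset`, `readOut7`), 0 `def … : Prop`, 0 sorry, 0 citation tags)

HONEST FRAMING.  A TOY — a CONSISTENCY CERTIFICATE for the binder family of OUR typed END; nothing about Bałaban's
minimiser, propagators or densities.  Finite four-torus programme, rung (B)+1 only — NOT infinite volume, NOT a mass gap,
NOT the Clay problem, NOT summit progress; (B), `BetaPertHyp`, (B^μ) not consumed.  NE7c (`T4IndicatorShell.ShellWeightBound`)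
is NOT PRINTED in [Balaban 1983–89] and NOT PROVED; «NE7c ⇐ the named binders» (trigger c3); (M1) realized on a toy ≠ NE7c.
Nothing printed is asserted; no estimate of Bałaban's is discharged; NOTHING in the countdown moves; spine PROVED 0∕9.
HONEST DEPENDENCY (cell): continuum YM on T⁴ ⇐ BetaPertH ∧ nine spine estimates (0/9 proved); BetaPertH ⇐ (D1) ∧ (D4) ∧
CAP+tail; G-an2-4 gates asym, D1 and NE2/3/4.

THE DATUM (any lattice `P`, level `j`, corner `lo`, directions `i₀ < i₁`; box `[lo, lo+2]`, comb `combBonds lo (lo+2)`).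
* `b₀ = ⟨castSite(lo + e_{i₀}), i₁⟩` — S89 f1's block bond (a box bond OFF the comb, `b₀_mem_blockBonds`); block `Λ := {b₀}`.
* `p₀ = ⟨castSite lo, i₀, i₁⟩` — the corner plaquette: its SECOND letter is `b₀`, the other three are COMB bonds
  (`comb_first`∕`comb_third`∕`comb_fourth`), so on every tree-gauged section `U = V[Λ := y][comb := 1]` its variable is
  `U(∂p₀) = y` — EXTERIOR-FREE (`plaqHol_p₀_sec`).
* `pathX U = U⟨lo,i₀⟩⁻¹·U⟨lo,i₁⟩·U⟨lo+e_{i₁},i₀⟩` — the comb path with `b₀`'s endpoints (`= 1` on sections, gauge-COVARIANT like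
  `U b₀`); `reset U := U[b₀ := pathX U]` — gauge-covariant (`reset_gaugeAct`), measurable, and on sections INDEPENDENT of the
  block variable (`reset_sec`): the device by which a KEPT CO-TEST reads the exterior only.
* `dist1_word_le`∕`dist1_plaqHol_le_of_agree_off` — two configurations agreeing off one bond `b`, `dist1((U′b)⁻¹Ub) ≤ δ`, have
  every plaquette variable within `4δ` (pure `GaugeGroup` algebra: `dist1` subadditive + conjugation invariant).
* `readOut7 e : ℂ^{m₀} →L M₂(ℂ)`, `Y ↦ Σ_a Y_{e(b₀,a)}·τ_a` — leaf-04's S88 read-out transported to the block `{b₀}`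
  (`‖ℓY‖ ≤ 3‖Y‖`, `ℓ(cplx x) = gen x`); `toyεθ_le_sin_half`: for `0 < S ≤ 10⁻⁵` the (SM) threshold `toyεθ S` is `≤ sin(S∕2)`.
File 2 (`ShellMeasureLandauEndAssembledDecayReachToy`) defines the density and FIRES S80 f6 on this datum.
-/

noncomputable section

open Set Metric NormedSpace MeasureTheory Function

namespace Summit.QuantumFields.BalabanUV.T4Continuum.ShellMeasureLandauEndAssembledDecayReachToyData

open scoped ENNReal Matrix.Norms.L2Operator
open Literature.MathematicalPhysics.QuantumFieldTheory.Balaban1983to89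
open GaugeField (GaugeInvariant plaqHol gaugeAct)
open T4CubeChartGnomonic (SU2)
open T4TreeGaugeFixing (NoClosedLoop fixTo fixTo_apply_of_mem fixTo_apply_of_not_mem noClosedLoop_combBonds)
open T4TiltOscillation (updateFinset_apply_of_mem updateFinset_apply_of_not_mem)
open T4AxialGaugeFixing (combBonds combSet mem_combBonds)
open T4AxialGaugeSmallField (castSite castSite_add_e castSite_injOn_box boxPlaqs boxBonds)
open B7Prop1Explicit (e e_apply)
open B8Lemma1NonAbelian (lowPart lowPart_apply)
open T4ReTrLipUnitary (plaqHol_gaugeAct)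
open T4CubePoincare (cube mem_cube_iff)
open T4CubeChartExp (toE expPt expChart expFibreChart block_mem_cube toE_mem_ball_of_mem_cube)
open T4ExpWindowSmallField (dist1_expPt_eq dist1_eq_norm_coe_sub_one)
open Literature.MathematicalPhysics.QuantumLattice (quatMatrix)
open ShellMeasureLandauHolonomyChart (cplx)
open ShellMeasureWilsonRealizedSU2 (wilsonU measurable_wilsonU M₂ gen coe_chart gen_mem_skewAdjoint)
open B11Prop6Scheme (Prop4Hyp mapT)
open T4ShellMeasure (SlotAntiConcentration)
open T4ShellMeasurePlaquette (expTail₂)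
open ShellMeasureLevelAssembly (classifier)
open ShellMeasureWilsonWords (wordExp wordExp_cons wordExp_nil)
open ShellMeasureMultiGridNorms (WSup)
open ShellMeasurePinnedNorm (pinW)
open ShellMeasureDecayKernelSums (kerOp kerOp_apply)
open ShellMeasureLandauHolonomy (solAt landauExp)
open ShellMeasureLandauHolonomyChart (holOf holOf_apply)
open ShellMeasureLandauHolonomySkew (readOutReal)
open ShellMeasureLandauEndFinalToy (toyU measurable_toyU gaugeInvariant_toyU tau norm_tau smul_mem_cube toyεθ toyεθ_pos
  solAt_zero landauExp_zero)
open ShellMeasureLandauEndAssembledToy (kerOp_zero_apply norm_kerOp_zero_le)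
open ShellMeasureLandauEndAssembledDecayReachBox (slotAC_realized_su2_landauChart_assembled_decay_of_core_collar)
open ShellMeasureLevelZeroBoxWitness (toyParams toyParams_sitesPerDir dir_zero_lt_one side_two_side side_two_nonwrapping)
open ShellMeasureLevelZeroBoxWitness (blockBonds boxPlaqF mem_blockBonds mem_boxPlaqF blockBonds_box
  disjoint_blockBonds_comb boxPlaqF_nonempty side_two_square le_add_e e_apply_nonneg)

variable {P : Params} {j : ℕ}

/-! ## §1 A four-letter perturbation bound (abstract gauge group algebra) -/

section Letters

variable {G : Type*} [GaugeGroup G]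

/-- **FOUR-LETTER PERTURBATION**: the plaquette word `l₁l₂l₃⁻¹l₄⁻¹` is within the four letter discrepancies
`dist1 (mᵢ⁻¹lᵢ)` of the word `m₁m₂m₃⁻¹m₄⁻¹` (peel one conjugated discrepancy at a time; `dist1` is conjugation invariant
and subadditive). [folklore] -/
theorem dist1_word_le (l₁ l₂ l₃ l₄ m₁ m₂ m₃ m₄ : G) :
    dist1 (l₁ * l₂ * l₃⁻¹ * l₄⁻¹) ≤ dist1 (m₁ * m₂ * m₃⁻¹ * m₄⁻¹) +
      (dist1 (m₁⁻¹ * l₁) + dist1 (m₂⁻¹ * l₂) + dist1 (m₃⁻¹ * l₃) + dist1 (m₄⁻¹ * l₄)) := by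
  have hA : l₁ * l₂ * l₃⁻¹ * l₄⁻¹ = m₁ * (m₁⁻¹ * l₁) * m₁⁻¹ * (m₁ * l₂ * l₃⁻¹ * l₄⁻¹) := by group
  have hB : m₁ * l₂ * l₃⁻¹ * l₄⁻¹ = (m₁ * m₂) * (m₂⁻¹ * l₂) * (m₁ * m₂)⁻¹ * (m₁ * m₂ * l₃⁻¹ * l₄⁻¹) := by group
  have hC : m₁ * m₂ * l₃⁻¹ * l₄⁻¹ =
      (m₁ * m₂) * (m₃⁻¹ * l₃)⁻¹ * (m₁ * m₂)⁻¹ * (m₁ * m₂ * m₃⁻¹ * l₄⁻¹) := by group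
  have hD : m₁ * m₂ * m₃⁻¹ * l₄⁻¹ =
      (m₁ * m₂ * m₃⁻¹) * (m₄⁻¹ * l₄)⁻¹ * (m₁ * m₂ * m₃⁻¹)⁻¹ * (m₁ * m₂ * m₃⁻¹ * m₄⁻¹) := by group
  have sA := GaugeGroup.dist1_mul_le (m₁ * (m₁⁻¹ * l₁) * m₁⁻¹) (m₁ * l₂ * l₃⁻¹ * l₄⁻¹)
  have sB := GaugeGroup.dist1_mul_le ((m₁ * m₂) * (m₂⁻¹ * l₂) * (m₁ * m₂)⁻¹) (m₁ * m₂ * l₃⁻¹ * l₄⁻¹)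
  have sC := GaugeGroup.dist1_mul_le ((m₁ * m₂) * (m₃⁻¹ * l₃)⁻¹ * (m₁ * m₂)⁻¹) (m₁ * m₂ * m₃⁻¹ * l₄⁻¹)
  have sD := GaugeGroup.dist1_mul_le ((m₁ * m₂ * m₃⁻¹) * (m₄⁻¹ * l₄)⁻¹ * (m₁ * m₂ * m₃⁻¹)⁻¹)
    (m₁ * m₂ * m₃⁻¹ * m₄⁻¹)
  rw [GaugeGroup.dist1_conj] at sA sB sC sD
  rw [GaugeGroup.dist1_inv] at sC sD
  rw [← hA] at sA; rw [← hB] at sB; rw [← hC] at sC; rw [← hD] at sD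
  linarith

/-- … hence: two configurations that agree off one bond `b`, with `dist1 ((U′ b)⁻¹ U b) ≤ δ` (`0 ≤ δ`), have plaquette
variables within `4δ` of each other. [folklore] -/
theorem dist1_plaqHol_le_of_agree_off {U U' : GaugeField P j G} {b : PBond P j} {δ : ℝ} (hδ : 0 ≤ δ)
    (hoff : ∀ b', b' ≠ b → U' b' = U b') (hb : dist1 ((U' b)⁻¹ * U b) ≤ δ) (q : Plaq P j) :
    dist1 (plaqHol U q) ≤ dist1 (plaqHol U' q) + 4 * δ := by
  have hle : ∀ b', dist1 ((U' b')⁻¹ * U b') ≤ δ := fun b' => by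
    by_cases h : b' = b
    · rw [h]; exact hb
    · rw [hoff b' h, inv_mul_cancel, GaugeGroup.dist1_one]; exact hδ
  have h := dist1_word_le (U ⟨q.src, q.μ⟩) (U ⟨q.src.shift q.μ, q.ν⟩) (U ⟨q.src.shift q.ν, q.μ⟩) (U ⟨q.src, q.ν⟩)
    (U' ⟨q.src, q.μ⟩) (U' ⟨q.src.shift q.μ, q.ν⟩) (U' ⟨q.src.shift q.ν, q.μ⟩) (U' ⟨q.src, q.ν⟩)
  have e1 : plaqHol U q = U ⟨q.src, q.μ⟩ * U ⟨q.src.shift q.μ, q.ν⟩ * (U ⟨q.src.shift q.ν, q.μ⟩)⁻¹ *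
      (U ⟨q.src, q.ν⟩)⁻¹ := rfl
  have e2 : plaqHol U' q = U' ⟨q.src, q.μ⟩ * U' ⟨q.src.shift q.μ, q.ν⟩ * (U' ⟨q.src.shift q.ν, q.μ⟩)⁻¹ *
      (U' ⟨q.src, q.ν⟩)⁻¹ := rfl
  rw [e1, e2]
  linarith [hle ⟨q.src, q.μ⟩, hle ⟨q.src.shift q.μ, q.ν⟩, hle ⟨q.src.shift q.ν, q.μ⟩, hle ⟨q.src, q.ν⟩]

end Letters

/-! ## §2 The corner datum of a side-2 box: comb letters, the block bond, section values -/

section Corner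

variable (lo : Fin P.d → ℤ) (i₀ i₁ : Fin P.d)

/-- the BLOCK BOND of the witness: `b₀ = ⟨castSite (lo + e_{i₀}), i₁⟩` (S89 f1's nonempty-block witness). [folklore] -/
def b₀ : PBond P j := ⟨castSite (lo + e i₀), i₁⟩

/-- the CORNER PLAQUETTE `p₀ = ⟨castSite lo, i₀, i₁⟩` (its second letter is `b₀`, the other three are comb bonds).
[folklore] -/
def p₀ (h01 : i₀ < i₁) : Plaq P j := ⟨castSite lo, i₀, i₁, h01⟩

/-- the COMB PATH with `b₀`'s endpoints: `(U⟨lo, i₀⟩)⁻¹ · U⟨lo, i₁⟩ · U⟨lo + e_{i₁}, i₀⟩` (three comb bonds — the other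
three letters of `p₀`). [folklore] -/
def pathX (U : GaugeField P j SU2) : SU2 :=
  (U ⟨castSite lo, i₀⟩)⁻¹ * U ⟨castSite lo, i₁⟩ * U ⟨castSite (lo + e i₁), i₀⟩

/-- the RESET configuration: `U` with its `b₀`-variable replaced by the comb path (gauge-COVARIANT, and on every
tree-gauged section independent of the block variable). [folklore] -/
def reset [DecidableEq (PBond P j)] (U : GaugeField P j SU2) : GaugeField P j SU2 :=
  Function.update U (b₀ lo i₀ i₁) (pathX lo i₀ i₁ U)

variable {lo i₀ i₁}

/-- comb criterion: a box bond `⟨castSite x, μ⟩` whose source agrees with the corner below direction `μ`. [folklore] -/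
theorem mem_combBonds_of {hi x : Fin P.d → ℤ} {μ : Fin P.d} (hlo : lo ≤ x) (hhi : x + e μ ≤ hi)
    (hlow : ∀ κ, κ < μ → x κ = lo κ) : (⟨castSite x, μ⟩ : PBond P j) ∈ combBonds lo hi := by
  refine mem_combBonds.2 ⟨x, hlo, hhi, rfl, funext fun κ => ?_⟩
  simp only [lowPart_apply, Pi.sub_apply]
  split_ifs with h
  · rw [hlow κ h, sub_self]; rfl
  · rfl

/-- `lo + e_μ ≤ lo + 2`. [folklore] -/
theorem add_e_le_two (μ : Fin P.d) : lo + e μ ≤ fun κ => lo κ + 2 := fun κ => by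
  simp only [Pi.add_apply, e_apply]; split_ifs <;> omega

/-- `lo + e_μ + e_ν ≤ lo + 2`. [folklore] -/
theorem add_e_add_e_le_two (μ ν : Fin P.d) : lo + e μ + e ν ≤ fun κ => lo κ + 2 := fun κ => by
  simp only [Pi.add_apply, e_apply]; split_ifs <;> omega

/-- the first letter of `p₀` is a comb bond. [folklore] -/
theorem comb_first : (⟨castSite lo, i₀⟩ : PBond P j) ∈ combBonds lo (fun κ => lo κ + 2) :=
  mem_combBonds_of le_rfl (add_e_le_two i₀) fun _ _ => rfl

/-- the fourth letter of `p₀` is a comb bond. [folklore] -/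
theorem comb_fourth : (⟨castSite lo, i₁⟩ : PBond P j) ∈ combBonds lo (fun κ => lo κ + 2) :=
  mem_combBonds_of le_rfl (add_e_le_two i₁) fun _ _ => rfl

/-- the third letter of `p₀` is a comb bond (`i₀ < i₁`: below `i₀` the offset `e_{i₁}` vanishes). [folklore] -/
theorem comb_third (h01 : i₀ < i₁) : (⟨castSite (lo + e i₁), i₀⟩ : PBond P j) ∈ combBonds lo (fun κ => lo κ + 2) :=
  mem_combBonds_of (le_add_e lo i₁) (add_e_add_e_le_two i₁ i₀) fun κ hκ => by
    have hne : κ ≠ i₁ := fun h => by rw [h] at hκ; exact lt_asymm hκ h01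
    simp [e_apply, hne]

/-- `b₀` is a BLOCK bond: a box bond OFF the comb (S89 f1's argument; non-wrapping box). [folklore] -/
theorem b₀_mem_blockBonds (hN : ∀ κ, (fun κ => lo κ + 2) κ - lo κ < P.sitesPerDir j) (h01 : i₀ < i₁) :
    b₀ lo i₀ i₁ ∈ (blockBonds lo (fun κ => lo κ + 2) : Finset (PBond P j)) := by
  refine mem_blockBonds.2 ⟨⟨lo + e i₀, le_add_e lo i₀, add_e_add_e_le_two i₀ i₁, rfl⟩, ?_⟩
  rintro ⟨x, hlox, hxhi, hsrc, hlow⟩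
  simp only [b₀] at hxhi hsrc hlow
  have hxle : x ≤ fun κ => lo κ + 2 := fun κ => by
    have h1 := hxhi κ; simp only [Pi.add_apply] at h1 ⊢; linarith [e_apply_nonneg (P := P) i₁ κ]
  have hx : x = lo + e i₀ := castSite_injOn_box hN hlox hxle (le_add_e lo i₀) (add_e_le_two i₀) hsrc.symm
  have h := congr_fun hlow i₀
  rw [hx, lowPart_apply, if_pos h01] at h
  simp [e_apply] at h

/-- `b₀ ∉` the comb. [folklore] -/
theorem b₀_not_mem_comb (hN : ∀ κ, (fun κ => lo κ + 2) κ - lo κ < P.sitesPerDir j) (h01 : i₀ < i₁) :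
    b₀ lo i₀ i₁ ∉ (combBonds lo (fun κ => lo κ + 2) : Finset (PBond P j)) := fun h =>
  (mem_blockBonds.1 (b₀_mem_blockBonds hN h01)).2 (mem_combBonds.1 h)

/-- `hΛbox` for the singleton block. [folklore] -/
theorem singleton_box (hN : ∀ κ, (fun κ => lo κ + 2) κ - lo κ < P.sitesPerDir j) (h01 : i₀ < i₁) :
    ∀ b ∈ ({b₀ lo i₀ i₁} : Finset (PBond P j)), b ∈ boxBonds lo (fun κ => lo κ + 2) := fun b hb => by
  rw [Finset.mem_singleton.1 hb]; exact blockBonds_box lo _ _ (b₀_mem_blockBonds hN h01)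

/-- `hΛcomb` for the singleton block. [folklore] -/
theorem singleton_comb (hN : ∀ κ, (fun κ => lo κ + 2) κ - lo κ < P.sitesPerDir j) (h01 : i₀ < i₁) :
    Disjoint ({b₀ lo i₀ i₁} : Finset (PBond P j)) (combBonds lo (fun κ => lo κ + 2)) :=
  Finset.disjoint_singleton_left.2 (b₀_not_mem_comb hN h01)

variable [DecidableEq (PBond P j)]

/-- SECTION VALUE on the comb: `1`. [folklore] -/
theorem sec_comb {b : PBond P j} (hb : b ∈ combBonds lo (fun κ => lo κ + 2)) (V : GaugeField P j SU2)
    (y : ↥({b₀ lo i₀ i₁} : Finset (PBond P j)) → SU2) :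
    fixTo (combBonds lo (fun κ => lo κ + 2)) 1 (updateFinset V {b₀ lo i₀ i₁} y) b = 1 :=
  fixTo_apply_of_mem hb _ _

/-- SECTION VALUE at the block bond: the block variable. [folklore] -/
theorem sec_b₀ (hN : ∀ κ, (fun κ => lo κ + 2) κ - lo κ < P.sitesPerDir j) (h01 : i₀ < i₁) (V : GaugeField P j SU2)
    (y : ↥({b₀ lo i₀ i₁} : Finset (PBond P j)) → SU2) :
    fixTo (combBonds lo (fun κ => lo κ + 2)) 1 (updateFinset V {b₀ lo i₀ i₁} y) (b₀ lo i₀ i₁) =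
      y ⟨b₀ lo i₀ i₁, Finset.mem_singleton_self _⟩ := by
  rw [fixTo_apply_of_not_mem (b₀_not_mem_comb hN h01), updateFinset_apply_of_mem]

/-- **THE CORNER PLAQUETTE ON A SECTION IS THE BLOCK VARIABLE** — exterior-FREE: `hol p₀ = 1 · y · 1⁻¹ · 1⁻¹ = y`.
[folklore] -/
theorem plaqHol_p₀_sec (hN : ∀ κ, (fun κ => lo κ + 2) κ - lo κ < P.sitesPerDir j) (h01 : i₀ < i₁)
    (V : GaugeField P j SU2) (y : ↥({b₀ lo i₀ i₁} : Finset (PBond P j)) → SU2) :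
    plaqHol (fixTo (combBonds lo (fun κ => lo κ + 2)) 1 (updateFinset V {b₀ lo i₀ i₁} y)) (p₀ lo i₀ i₁ h01) =
      y ⟨b₀ lo i₀ i₁, Finset.mem_singleton_self _⟩ := by
  have e1 : plaqHol (fixTo (combBonds lo (fun κ => lo κ + 2)) 1 (updateFinset V {b₀ lo i₀ i₁} y)) (p₀ lo i₀ i₁ h01) =
      fixTo (combBonds lo (fun κ => lo κ + 2)) 1 (updateFinset V {b₀ lo i₀ i₁} y) ⟨castSite lo, i₀⟩ *
      fixTo (combBonds lo (fun κ => lo κ + 2)) 1 (updateFinset V {b₀ lo i₀ i₁} y) ⟨(castSite lo).shift i₀, i₁⟩ *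
      (fixTo (combBonds lo (fun κ => lo κ + 2)) 1 (updateFinset V {b₀ lo i₀ i₁} y) ⟨(castSite lo).shift i₁, i₀⟩)⁻¹ *
      (fixTo (combBonds lo (fun κ => lo κ + 2)) 1 (updateFinset V {b₀ lo i₀ i₁} y) ⟨castSite lo, i₁⟩)⁻¹ := rfl
  have h2 : (⟨(castSite lo : Site P j).shift i₀, i₁⟩ : PBond P j) = b₀ lo i₀ i₁ := by rw [← castSite_add_e]; rfl
  have h3 : (⟨(castSite lo : Site P j).shift i₁, i₀⟩ : PBond P j) = ⟨castSite (lo + e i₁), i₀⟩ := by rw [← castSite_add_e]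
  rw [e1, h2, h3, sec_comb comb_first, sec_comb (comb_third h01), sec_comb comb_fourth, sec_b₀ hN h01]
  simp

/-- the comb path on a section is `1`. [folklore] -/
theorem pathX_sec (h01 : i₀ < i₁) (V : GaugeField P j SU2) (y : ↥({b₀ lo i₀ i₁} : Finset (PBond P j)) → SU2) :
    pathX lo i₀ i₁ (fixTo (combBonds lo (fun κ => lo κ + 2)) 1 (updateFinset V {b₀ lo i₀ i₁} y)) = 1 := by
  rw [pathX, sec_comb comb_first, sec_comb (comb_third h01), sec_comb comb_fourth]
  simp

/-- unfolding `reset`. [folklore] -/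
theorem reset_apply (U : GaugeField P j SU2) (b : PBond P j) :
    reset lo i₀ i₁ U b = if b = b₀ lo i₀ i₁ then pathX lo i₀ i₁ U else U b := by
  unfold reset; exact Function.update_apply _ _ _ _

/-- **THE RESET OF A SECTION FORGETS THE BLOCK VARIABLE**: `reset (section_V y) = section_V 1`. [folklore] -/
theorem reset_sec (h01 : i₀ < i₁) (V : GaugeField P j SU2) (y : ↥({b₀ lo i₀ i₁} : Finset (PBond P j)) → SU2) :
    reset lo i₀ i₁ (fixTo (combBonds lo (fun κ => lo κ + 2)) 1 (updateFinset V {b₀ lo i₀ i₁} y)) =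
      fixTo (combBonds lo (fun κ => lo κ + 2)) 1 (updateFinset V {b₀ lo i₀ i₁} fun _ => 1) := by
  funext b
  rw [reset_apply]
  by_cases hb : b = b₀ lo i₀ i₁
  · rw [if_pos hb, pathX_sec h01, hb]
    by_cases hc : (b₀ lo i₀ i₁ : PBond P j) ∈ (combBonds lo (fun κ => lo κ + 2) : Finset (PBond P j))
    · rw [fixTo_apply_of_mem hc]; rfl
    · rw [fixTo_apply_of_not_mem hc, updateFinset_apply_of_mem _ _ (Finset.mem_singleton_self _)]
  · rw [if_neg hb]
    by_cases hc : b ∈ (combBonds lo (fun κ => lo κ + 2) : Finset (PBond P j))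
    · rw [fixTo_apply_of_mem hc, fixTo_apply_of_mem hc]
    · have hb' : b ∉ ({b₀ lo i₀ i₁} : Finset (PBond P j)) := by rwa [Finset.mem_singleton]
      rw [fixTo_apply_of_not_mem hc, fixTo_apply_of_not_mem hc, updateFinset_apply_of_not_mem _ _ hb',
        updateFinset_apply_of_not_mem _ _ hb']

omit [DecidableEq (PBond P j)] in
/-- the comb path is GAUGE-COVARIANT with `b₀`'s endpoints. [folklore] -/
theorem pathX_gaugeAct (u : GaugeTransf P j SU2) (U : GaugeField P j SU2) :
    pathX lo i₀ i₁ (gaugeAct u U) = u (b₀ lo i₀ i₁).src * pathX lo i₀ i₁ U * (u (b₀ lo i₀ i₁).tgt)⁻¹ := by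
  simp only [pathX, b₀, GaugeField.gaugeAct, PBond.tgt, ← castSite_add_e, add_right_comm lo (e i₁) (e i₀)]
  group

/-- `reset` is GAUGE-COVARIANT. [folklore] -/
theorem reset_gaugeAct (u : GaugeTransf P j SU2) (U : GaugeField P j SU2) :
    reset lo i₀ i₁ (gaugeAct u U) = gaugeAct u (reset lo i₀ i₁ U) := by
  funext b
  rw [reset_apply]
  by_cases hb : b = b₀ lo i₀ i₁
  · rw [if_pos hb, pathX_gaugeAct, hb]
    show _ = u (b₀ lo i₀ i₁).src * reset lo i₀ i₁ U (b₀ lo i₀ i₁) * (u (b₀ lo i₀ i₁).tgt)⁻¹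
    rw [reset_apply, if_pos rfl]
  · rw [if_neg hb]
    show u b.src * U b * (u b.tgt)⁻¹ = u b.src * reset lo i₀ i₁ U b * (u b.tgt)⁻¹
    rw [reset_apply, if_neg hb]

omit [DecidableEq (PBond P j)] in
/-- the comb path is measurable in the configuration. [folklore] -/
theorem measurable_pathX : Measurable fun U : GaugeField P j SU2 => pathX lo i₀ i₁ U := by
  unfold pathX
  exact ((Missing.measurable_eval _).inv.mul (Missing.measurable_eval _)).mul (Missing.measurable_eval _)

/-- `reset` is measurable. [folklore] -/
theorem measurable_reset : Measurable fun U : GaugeField P j SU2 => reset lo i₀ i₁ U := by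
  refine measurable_pi_lambda _ fun b => ?_
  by_cases hb : b = b₀ lo i₀ i₁
  · simp only [reset_apply, hb, if_true]; exact measurable_pathX
  · simp only [reset_apply, hb, if_false]; exact measurable_pi_apply b

omit [DecidableEq (PBond P j)] in
/-- the box classifier `wilsonU` is gauge invariant. [folklore] -/
theorem wilsonU_gaugeAct {Pu : Finset (Plaq P j)} (hPu : Pu.Nonempty) (u : GaugeTransf P j SU2)
    (U : GaugeField P j SU2) : wilsonU hPu (gaugeAct u U) = wilsonU hPu U := by
  simp only [wilsonU, plaqHol_gaugeAct, GaugeGroup.dist1_conj]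

end Corner

/-! ## §3 The block read-out and the threshold-vs-radius number -/

section ReadOut

variable (lo : Fin P.d → ℤ) {i₀ i₁ : Fin P.d}

/-- the toy READ-OUT of the block bond: `ℓ Y = Σ_a Y_{e(b₀,a)} · τ_a` (S88's read-out on the block `{b₀}`). [folklore] -/
def readOut7 {m₀ : ℕ} (e : ↥({b₀ lo i₀ i₁} : Finset (PBond P j)) × Fin 3 ≃ Fin m₀) : (Fin m₀ → ℂ) →L[ℂ] M₂ :=
  ∑ a : Fin 3, (ContinuousLinearMap.proj (R := ℂ) (φ := fun _ : Fin m₀ => ℂ)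
    (e (⟨b₀ lo i₀ i₁, Finset.mem_singleton_self _⟩, a))).smulRight (tau a)

/-- `ℓ Y = Σ_a Y_{e(b₀,a)} · τ_a`. [folklore] -/
theorem readOut7_apply {m₀ : ℕ} (e : ↥({b₀ lo i₀ i₁} : Finset (PBond P j)) × Fin 3 ≃ Fin m₀) (Y : Fin m₀ → ℂ) :
    readOut7 lo e Y = ∑ a : Fin 3, Y (e (⟨b₀ lo i₀ i₁, Finset.mem_singleton_self _⟩, a)) • tau a := by
  simp [readOut7]

/-- `‖ℓ Y‖ ≤ 3‖Y‖`. [folklore] -/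
theorem norm_readOut7_le {m₀ : ℕ} (e : ↥({b₀ lo i₀ i₁} : Finset (PBond P j)) × Fin 3 ≃ Fin m₀) (Y : Fin m₀ → ℂ) :
    ‖readOut7 lo e Y‖ ≤ 3 * ‖Y‖ := by
  rw [readOut7_apply]
  calc ‖∑ a : Fin 3, Y (e (⟨b₀ lo i₀ i₁, Finset.mem_singleton_self _⟩, a)) • tau a‖
      ≤ ∑ a : Fin 3, ‖Y (e (⟨b₀ lo i₀ i₁, Finset.mem_singleton_self _⟩, a)) • tau a‖ := norm_sum_le _ _
    _ ≤ ∑ _a : Fin 3, ‖Y‖ := Finset.sum_le_sum fun a _ => by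
        rw [norm_smul, norm_tau, mul_one]; exact norm_le_pi_norm Y _
    _ = 3 * ‖Y‖ := by simp

/-- the dictionary for the read-out: `ℓ (cplx x) = gen x` (the chart generator of the block bond). [folklore] -/
theorem readOut7_cplx {m₀ : ℕ} (e : ↥({b₀ lo i₀ i₁} : Finset (PBond P j)) × Fin 3 ≃ Fin m₀) (x : Fin m₀ → ℝ) :
    readOut7 lo e (cplx x) = gen {b₀ lo i₀ i₁} e ⟨b₀ lo i₀ i₁, Finset.mem_singleton_self _⟩ x := by
  rw [readOut7_apply]
  unfold gen tau cplx
  ext i j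
  fin_cases i <;> fin_cases j <;>
    simp [Matrix.sum_apply, Fin.sum_univ_three, quatMatrix, T4HaarSU2ExpChart.imQuat_apply, Complex.ext_iff]
/-- the (SM) threshold sits INSIDE the core radius for a small window: `toyεθ S ≤ sin(S∕2)` for `0 < S ≤ 10⁻⁵`
(S88 §5's Jordan argument, one factor of two tighter). [folklore] -/
theorem toyεθ_le_sin_half {S : ℝ} (hS : 0 < S) (hS5 : S ≤ 1 / 100000) : toyεθ S * 1 ^ 2 ≤ Real.sin (S / 2) := by
  have hj : S / 4 ≤ Real.sin (S / 2) := by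
    have h := Real.mul_le_sin (by linarith : 0 ≤ S / 2) (by linarith [Real.pi_gt_three] : S / 2 ≤ Real.pi / 2)
    have : S / 4 ≤ 2 / Real.pi * (S / 2) := by
      rw [div_mul_eq_mul_div, le_div_iff₀ Real.pi_pos]; nlinarith [Real.pi_le_four]
    linarith
  have hR : 1 / (12 * S) ≤ 1 / (6 * S) - 1 := by
    rw [div_sub_one (by positivity), div_le_div_iff₀ (by positivity) (by positivity)]; nlinarith
  have h1 : toyεθ S ≤ 144 / (1 / (12 * S)) ^ 2 := by
    rw [toyεθ, show (1 / 6 : ℝ) / S = 1 / (6 * S) by rw [div_div]]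
    exact div_le_div_of_nonneg_left (by norm_num) (by positivity) (pow_le_pow_left₀ (by positivity) hR 2)
  have h2 : 144 / (1 / (12 * S)) ^ 2 = 20736 * S ^ 2 := by
    field_simp; ring
  rw [one_pow, mul_one]
  nlinarith [h1, h2, hj]

end ReadOut

end Summit.QuantumFields.BalabanUV.T4Continuum.ShellMeasureLandauEndAssembledDecayReachToyData

end
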